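import Summits.QuantumFields.YangMills.Theorems.UnitScaleTiltProp7CornerCombSourcedStructure
import Summits.QuantumFields.YangMills.Theorems.UnitScaleTiltProp7CombPeriodCellDict
import HarnessLib

/-!
# Route `UnitScaleTilt`, crux K1 «MinimiserStabilityRegPr» (stmt-QuantumFields-19200), route-R E′ (A′)-on-Σ, P-A2 (β), row «(n3)-comb» —
# (O2) GROUNDWORK, file F-8b-1: THE SOURCED CORNER-COMB FAMILIES OF PERIODIC DATA ARE PERIODIC; THEY EXIST; THE SOURCE SPLITS OFF LINEARLY

«(O2) groundwork — not consumed by any displayed row before the freeze lifts» (★★OWNER `ym3-torus-plan` g29∕g30 RULINGS №20 (2), №22 (c) «(II) GO»).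
Cell `ym3-torus`, width seat `ym-ust-19200-w5` (gen 8); pen F-8b «THE CELL THEOREM» named by ★routeR-w1 g9 (PENS ROUND 5, 2026-08-29 10:02Z), file 1 of F-8b
(«recursion inhabitation»).  THEOREMS ONLY (0 `def`, 0 `sorry`); `--supports stmt-QuantumFields-19200 --as helper`, count-neutral.  YM₃ on T³ is a ladder rung (R3), not the
Clay problem; nothing here claims `hMcomb`, (β), `hPA2`, the stub, the crux, d = 4 or the mass gap.

THE POINT.  F-8b's cell theorem feeds the SOURCED reduced family `G̃` and gauge function `Λ` of ✓F-7a `Prop7CornerCombSourcedStructure.sourced_cornerComb_structure` (at the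
corner charges `CM k X y := F̂^{Ūᵏ}X(L•y)`) into the period-cell rows ⧗F-7b-1∕F-7b-2 (★routeR-w4) and F-6d-3 (★routeR-w6), all of which read `N_k`-PERIODIC level-`k` fields on `ℤᵈ`
(organisation W1: `N_k = N_{k+1}·L`).  This file supplies the three zero-content facts the knit needs about these families:
* §1 TRANSLATION COVARIANCE of the linearised one-step operator: lit ✓`hol_shiftCfg`∕`Wcx_shiftCfg`∕`Xavg_shiftCfg` (B12) extended to the transported sums `tsum` (`tstep_shiftCfg`,
  `tsum_shiftCfg`), the covariant block mean `FhatCov_shiftCfg`, and the written-out true step `trueStep_shiftCfg`;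
* §2 ★★ `isPeriodic_sourced_families`: on a finite tower `k ≤ k₀` (`N k = N (k+1)·L`, `k < k₀`), if `Ūᵏ` is `N_k`-periodic (✓F-8a `isPeriodic_avgIter`), the source `rem k` is
  `N_{k+1}`-periodic and `G̃ 0` is `N_0`-periodic, then every `G̃ k`, `Λ k` is `N_k`-periodic (induction through the recursion; + the coordinate forms the rows consume);
* §3 EXISTENCE by recursion on the level (`exists_sourced_reduced_family`, `exists_gauge_family`, as ✓F-4 §4) and the LINEAR SPLIT ★`sourced_recursion_of_split`: for the
  sourceless family `G^{lin}` from `Y` and the sourced family `N` from `0`, `G̃ := G^{lin} + N` obeys the sourced recursion from `Y` (✓`trueStep_add`, lit ✓`FhatCov_add`,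
  `conjR_add`) — the split behind w5's `#levels` cure (F-7b-2 sourceless on `G^{lin}`, the source carried by the mass line of `N`, ✓F-7c-2∕3).
HONEST SCOPE.  Finite-sum identities and inductions on the level; no estimate, no window, no constant.

References: T. Bałaban, CMP **98** (1985) 17–51 [Balaban1985Averaging] ((9) p.18, (42)–(43) pp.23–24, (58)–(61) p.28, (68)–(69) p.29, (112) p.34, (119)–(122) pp.35–36);
CMP **109** (1987) 249–301 [Balaban1987RG1] ((0.1) p.251, (4.16) p.285: periodic fields read on `ℤᵈ`); CMP **95** (1984) 17–40 [Balaban1984PropagatorsI] ((1.18)–(1.20)).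
-/

set_option autoImplicit false

noncomputable section

open scoped BigOperators

namespace Summit.QuantumFields.YangMills.Theorems.Prop7CornerCombFamiliesPeriodic

open NormedSpace
open Literature.MathematicalPhysics.QuantumFieldTheory.Balaban1983to89
open ExpMeanLog (eml)
open B7Prop1Explicit renaming Site → LSite
open B7Prop1Explicit (Letter e hol seg boxVec gammaWord treeWord Wcx Xavg bavg expUnit stepHol)
open B7Prop2Explicit (avgIter)
open B7Eq78Linearization (conjR conjR_apply conjR_add)
open B7Prop3GeneralRotated (tsum tstep tsum_nil tsum_cons)
open B7Prop3GeneralLinear (FhatCov)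
open B7Prop3GeneralTild (tsum_add FhatCov_add)
open B12Ineq417Flat (shiftCfg shiftCfg_apply stepHol_shiftCfg hol_shiftCfg Wcx_shiftCfg Xavg_shiftCfg)
open T4TermwiseTorus (IsPeriodic)
open Summit.QuantumFields.YangMills.Theorems.Prop7CombPeriodCellDict (shiftCfg_eq_of_isPeriodic)
open Summit.QuantumFields.YangMills.Theorems.Prop7CornerCombStructure (trueStep_add)

variable {d : ℕ} {𝔸 : Type*} [CStarAlgebra 𝔸]

/-! ## §1 Translation covariance of the transported sums, the covariant block mean and the true step -/

/-- One letter of the transported sum is translation covariant. [cite: Balaban1985Averaging, (58)–(61) p.28, (9) p.18] -/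
theorem tstep_shiftCfg (a : LSite d) (V : LSite d → Fin d → 𝔸ˣ) (A : LSite d → Fin d → 𝔸) (x : LSite d) (l : Letter d) :
    tstep (shiftCfg a V) (shiftCfg a A) x l = tstep V A (x + a) l := by
  unfold tstep
  rw [stepHol_shiftCfg]
  simp only [shiftCfg_apply, add_right_comm x l.vec a]

/-- **The transported sums `(R_{0,x}A)(Γ)` are translation covariant**: `tsum (t_aV) (t_aA) x Γ = tsum V A (x + a) Γ`. [cite: Balaban1985Averaging, (58)–(61) p.28] -/
theorem tsum_shiftCfg (a : LSite d) (V : LSite d → Fin d → 𝔸ˣ) (A : LSite d → Fin d → 𝔸) :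
    ∀ (x : LSite d) (w : List (Letter d)), tsum (shiftCfg a V) (shiftCfg a A) x w = tsum V A (x + a) w
  | x, [] => by rw [tsum_nil, tsum_nil]
  | x, l :: w => by
    rw [tsum_cons, tsum_cons, tstep_shiftCfg, stepHol_shiftCfg, tsum_shiftCfg a V A (x + l.vec) w, add_right_comm x l.vec a]

/-- **The covariant block mean `F̂^{V}A(y)` (112) is translation covariant.** [cite: Balaban1985Averaging, (112) p.34] -/
theorem FhatCov_shiftCfg (L : ℕ) (a : LSite d) (V : LSite d → Fin d → 𝔸ˣ) (A : LSite d → Fin d → 𝔸) (y : LSite d) :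
    FhatCov L (shiftCfg a V) (shiftCfg a A) y = FhatCov L V A (y + a) := by
  unfold FhatCov
  simp_rw [tsum_shiftCfg]

/-- **The written-out one-step true derivative `T_V(X)(q,κ)` (✓F-2b∕F-4) is translation covariant jointly in `(V, X)`.** [cite: Balaban1985Averaging, (119)–(122) pp.35–36] -/
theorem trueStep_shiftCfg (L : ℕ) (a : LSite d) (V : LSite d → Fin d → 𝔸ˣ) (X : LSite d → Fin d → 𝔸) (q : LSite d) (κ : Fin d) :
    fderiv ℂ (eml : ((Fin d → Fin L) → 𝔸) → 𝔸) (fun r => ((Wcx L (shiftCfg a V) q κ (boxVec L r) : 𝔸ˣ) : 𝔸))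
          (fun r => tsum (shiftCfg a V) (shiftCfg a X) q (gammaWord L κ (boxVec L r) ++ seg κ (-(L : ℤ))) * ((Wcx L (shiftCfg a V) q κ (boxVec L r) : 𝔸ˣ) : 𝔸))
          * (((expUnit (Xavg L (shiftCfg a V) q κ))⁻¹ : 𝔸ˣ) : 𝔸)
        + ((expUnit (Xavg L (shiftCfg a V) q κ) : 𝔸ˣ) : 𝔸) * tsum (shiftCfg a V) (shiftCfg a X) q (seg κ (L : ℤ))
          * (((expUnit (Xavg L (shiftCfg a V) q κ))⁻¹ : 𝔸ˣ) : 𝔸)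
      = fderiv ℂ (eml : ((Fin d → Fin L) → 𝔸) → 𝔸) (fun r => ((Wcx L V (q + a) κ (boxVec L r) : 𝔸ˣ) : 𝔸))
          (fun r => tsum V X (q + a) (gammaWord L κ (boxVec L r) ++ seg κ (-(L : ℤ))) * ((Wcx L V (q + a) κ (boxVec L r) : 𝔸ˣ) : 𝔸))
          * (((expUnit (Xavg L V (q + a) κ))⁻¹ : 𝔸ˣ) : 𝔸)
        + ((expUnit (Xavg L V (q + a) κ) : 𝔸ˣ) : 𝔸) * tsum V X (q + a) (seg κ (L : ℤ)) * (((expUnit (Xavg L V (q + a) κ))⁻¹ : 𝔸ˣ) : 𝔸) := by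
  simp_rw [Wcx_shiftCfg, Xavg_shiftCfg, tsum_shiftCfg]

/-! ## §2 ★★ Periodic data give periodic sourced families -/

/-- The corner of a shifted coarse site: `L•(z + N′•m) = L•z + (N′L)•m`. [folklore] -/
theorem smul_add_period (L N N' : ℕ) (hN : N = N' * L) (z m : LSite d) :
    (L : ℤ) • (z + (N' : ℤ) • m) = (L : ℤ) • z + (N : ℤ) • m := by
  rw [smul_add, smul_smul, hN]; push_cast; rw [mul_comm]

/-- A site function read through `IsPeriodic`: `f (x + N•m) = f x`. [folklore] -/
theorem apply_add_period_of_shiftCfg {β : Type*} {N : ℕ} {f : LSite d → β} (h : ∀ a : LSite d, shiftCfg ((N : ℤ) • a) f = f) (x m : LSite d) :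
    f (x + (N : ℤ) • m) = f x := by
  have := congrFun (h m) x
  rwa [shiftCfg_apply] at this

/-- ★★ **PERIODIC DATA GIVE PERIODIC SOURCED FAMILIES.**  A finite tower of levels `k ≤ k₀`, `N k = N (k+1)·L` for `k < k₀` (e.g. `N k = N′·L^{k₀−k}`, `period_tower_step`);
backgrounds `V k` `N_k`-periodic (for `V k = Ūᵏ` this is ✓F-8a `isPeriodic_avgIter`); a source
`rem k` that is `N_{k+1}`-periodic; the sourced reduced family `G̃` (recursion of ✓F-7a at the corner charges `F̂^{V k}X(L•y)`) with `G̃ 0` `N_0`-periodic, and its gauge function `Λ`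
(`Λ 0 = 0`, `Λ (k+1) y = F̂^{V k}G̃_k(L•y) + Λ k (L•y)`).  THEN every `G̃ k` and `Λ k`, `k ≤ k₀`, is `N_k`-periodic — induction on `k` through §1 (the
restriction to `k < k₀` in `hN` is essential: an unrestricted `N k = N (k+1)·L` forces `N ≡ 0`; ★routeR-w6 g9's read).
[cite: Balaban1987RG1, (0.1) p.251 (periodic fields on `ℤᵈ`); Balaban1985Averaging, (68)–(69) p.29, (112), (119)–(122)] -/
theorem isPeriodic_sourced_families (L : ℕ) (N : ℕ → ℕ) (k₀ : ℕ) (hN : ∀ k < k₀, N k = N (k + 1) * L) (V : ℕ → LSite d → Fin d → 𝔸ˣ)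
    (hV : ∀ k ≤ k₀, IsPeriodic (N k) (V k)) (rem : ℕ → LSite d → Fin d → 𝔸) (hrem : ∀ k < k₀, IsPeriodic (N (k + 1)) (rem k))
    (G : ℕ → LSite d → Fin d → 𝔸) (Λ : ℕ → LSite d → 𝔸) (hG0 : IsPeriodic (N 0) (G 0)) (hΛ0 : ∀ z, Λ 0 z = 0)
    (hGs : ∀ (k : ℕ) (z : LSite d) (κ : Fin d), G (k + 1) z κ
      = (fderiv ℂ (eml : ((Fin d → Fin L) → 𝔸) → 𝔸) (fun r => ((Wcx L (V k) ((L : ℤ) • z) κ (boxVec L r) : 𝔸ˣ) : 𝔸))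
            (fun r => tsum (V k) (G k) ((L : ℤ) • z) (gammaWord L κ (boxVec L r) ++ seg κ (-(L : ℤ))) * ((Wcx L (V k) ((L : ℤ) • z) κ (boxVec L r) : 𝔸ˣ) : 𝔸))
            * (((expUnit (Xavg L (V k) ((L : ℤ) • z) κ))⁻¹ : 𝔸ˣ) : 𝔸)
          + ((expUnit (Xavg L (V k) ((L : ℤ) • z) κ) : 𝔸ˣ) : 𝔸) * tsum (V k) (G k) ((L : ℤ) • z) (seg κ (L : ℤ))
            * (((expUnit (Xavg L (V k) ((L : ℤ) • z) κ))⁻¹ : 𝔸ˣ) : 𝔸))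
        - (FhatCov L (V k) (G k) ((L : ℤ) • z) - conjR (V (k + 1) z κ) (FhatCov L (V k) (G k) ((L : ℤ) • (z + e κ)))) + rem k z κ)
    (hΛs : ∀ (k : ℕ) (z : LSite d), Λ (k + 1) z = FhatCov L (V k) (G k) ((L : ℤ) • z) + Λ k ((L : ℤ) • z)) :
    ∀ k ≤ k₀, IsPeriodic (N k) (G k) ∧ IsPeriodic (N k) (Λ k) := by
  intro k
  induction k with
  | zero =>
    refine fun _ => ⟨hG0, fun x m => ?_⟩
    rw [hΛ0, hΛ0]
  | succ k ih =>
    intro hk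
    have hk' : k < k₀ := Nat.lt_of_succ_le hk
    obtain ⟨ihG, ihΛ⟩ := ih hk'.le
    have hVk : ∀ a : LSite d, shiftCfg ((N k : ℤ) • a) (V k) = V k := shiftCfg_eq_of_isPeriodic (hV k hk'.le)
    have hGk : ∀ a : LSite d, shiftCfg ((N k : ℤ) • a) (G k) = G k := shiftCfg_eq_of_isPeriodic ihG
    have hΛk : ∀ a : LSite d, shiftCfg ((N k : ℤ) • a) (Λ k) = Λ k := shiftCfg_eq_of_isPeriodic ihΛ
    -- the three covariant ingredients at a shifted corner
    have hT : ∀ (m z : LSite d) (κ : Fin d),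
        fderiv ℂ (eml : ((Fin d → Fin L) → 𝔸) → 𝔸) (fun r => ((Wcx L (V k) ((L : ℤ) • z + (N k : ℤ) • m) κ (boxVec L r) : 𝔸ˣ) : 𝔸))
            (fun r => tsum (V k) (G k) ((L : ℤ) • z + (N k : ℤ) • m) (gammaWord L κ (boxVec L r) ++ seg κ (-(L : ℤ)))
              * ((Wcx L (V k) ((L : ℤ) • z + (N k : ℤ) • m) κ (boxVec L r) : 𝔸ˣ) : 𝔸))
            * (((expUnit (Xavg L (V k) ((L : ℤ) • z + (N k : ℤ) • m) κ))⁻¹ : 𝔸ˣ) : 𝔸)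
          + ((expUnit (Xavg L (V k) ((L : ℤ) • z + (N k : ℤ) • m) κ) : 𝔸ˣ) : 𝔸) * tsum (V k) (G k) ((L : ℤ) • z + (N k : ℤ) • m) (seg κ (L : ℤ))
            * (((expUnit (Xavg L (V k) ((L : ℤ) • z + (N k : ℤ) • m) κ))⁻¹ : 𝔸ˣ) : 𝔸)
        = fderiv ℂ (eml : ((Fin d → Fin L) → 𝔸) → 𝔸) (fun r => ((Wcx L (V k) ((L : ℤ) • z) κ (boxVec L r) : 𝔸ˣ) : 𝔸))
            (fun r => tsum (V k) (G k) ((L : ℤ) • z) (gammaWord L κ (boxVec L r) ++ seg κ (-(L : ℤ))) * ((Wcx L (V k) ((L : ℤ) • z) κ (boxVec L r) : 𝔸ˣ) : 𝔸))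
            * (((expUnit (Xavg L (V k) ((L : ℤ) • z) κ))⁻¹ : 𝔸ˣ) : 𝔸)
          + ((expUnit (Xavg L (V k) ((L : ℤ) • z) κ) : 𝔸ˣ) : 𝔸) * tsum (V k) (G k) ((L : ℤ) • z) (seg κ (L : ℤ))
            * (((expUnit (Xavg L (V k) ((L : ℤ) • z) κ))⁻¹ : 𝔸ˣ) : 𝔸) := by
      intro m z κ
      rw [← trueStep_shiftCfg L ((N k : ℤ) • m) (V k) (G k) ((L : ℤ) • z) κ, hVk, hGk]
    have hF : ∀ (m y : LSite d), FhatCov L (V k) (G k) (y + (N k : ℤ) • m) = FhatCov L (V k) (G k) y := by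
      intro m y
      rw [← FhatCov_shiftCfg L ((N k : ℤ) • m) (V k) (G k) y, hVk, hGk]
    have hGsucc : IsPeriodic (N (k + 1)) (G (k + 1)) := by
      intro x m
      funext κ
      rw [hGs, hGs, smul_add_period L (N k) (N (k + 1)) (hN k hk') x m, hT, add_right_comm x ((N (k + 1) : ℤ) • m) (e κ),
        smul_add_period L (N k) (N (k + 1)) (hN k hk') (x + e κ) m, hF, hF, (hV (k + 1) hk) x m, (hrem k hk') x m]
    refine ⟨hGsucc, fun x m => ?_⟩
    rw [hΛs, hΛs, smul_add_period L (N k) (N (k + 1)) (hN k hk') x m, hF, ihΛ ((L : ℤ) • x) m]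

/-- The coordinate form the period-cell rows consume (⧗F-7b-1 `hX`, F-6d-3 `hGp`): `G̃ k (x + N_k•e ι) μ = G̃ k x μ`. [cite: Balaban1987RG1, (0.1) p.251] -/
theorem apply_add_period_of_isPeriodic {β : Type*} {N : ℕ} {X : LSite d → Fin d → β} (h : IsPeriodic N X) (x : LSite d) (ι μ : Fin d) :
    X (x + ((N : ℕ) : ℤ) • e ι) μ = X x μ := by
  rw [h x (e ι)]

/-- The same for a site function (the gauge function `Λ k`). [cite: Balaban1987RG1, (0.1) p.251] -/
theorem apply_add_period_of_isPeriodic' {β : Type*} {N : ℕ} {f : LSite d → β} (h : IsPeriodic N f) (x : LSite d) (ι : Fin d) :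
    f (x + ((N : ℕ) : ℤ) • e ι) = f x := h x (e ι)

/-- The tower of periods: `N k := N₀′·L^{k₀−k}` satisfies `N k = N (k+1)·L` for `k < k₀`. [folklore] -/
theorem period_tower_step (N' L k₀ k : ℕ) (hk : k < k₀) : N' * L ^ (k₀ - k) = N' * L ^ (k₀ - (k + 1)) * L := by
  rw [mul_assoc, ← pow_succ, show k₀ - (k + 1) + 1 = k₀ - k by omega]

/-! ## §3 Existence by recursion on the level, and the linear split of the source -/

/-- **The sourced reduced family and its gauge function exist** (recursion on the level; the texts of ✓F-7a's `hG0`∕`hGs`∕`hΛ0`∕`hΛs` with the source `rem`, for ANY corner-charge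
maps `CM`). Zero content. [cite: Balaban1985Averaging, (68)–(69) p.29; Balaban1984PropagatorsI, (1.18)–(1.20)] -/
theorem exists_sourced_reduced_family (L : ℕ) (U₀ : LSite d → Fin d → 𝔸ˣ) (Y : LSite d → Fin d → 𝔸) (CM : ℕ → (LSite d → Fin d → 𝔸) → LSite d → 𝔸)
    (rem : ℕ → LSite d → Fin d → 𝔸) :
    ∃ (G : ℕ → LSite d → Fin d → 𝔸) (Λ : ℕ → LSite d → 𝔸), G 0 = Y ∧ (∀ z, Λ 0 z = 0) ∧
      (∀ (k : ℕ) (z : LSite d) (κ : Fin d), G (k + 1) z κ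
        = (fderiv ℂ (eml : ((Fin d → Fin L) → 𝔸) → 𝔸) (fun r => ((Wcx L (avgIter L U₀ k) ((L : ℤ) • z) κ (boxVec L r) : 𝔸ˣ) : 𝔸))
              (fun r => tsum (avgIter L U₀ k) (G k) ((L : ℤ) • z) (gammaWord L κ (boxVec L r) ++ seg κ (-(L : ℤ)))
                * ((Wcx L (avgIter L U₀ k) ((L : ℤ) • z) κ (boxVec L r) : 𝔸ˣ) : 𝔸))
              * (((expUnit (Xavg L (avgIter L U₀ k) ((L : ℤ) • z) κ))⁻¹ : 𝔸ˣ) : 𝔸)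
            + ((expUnit (Xavg L (avgIter L U₀ k) ((L : ℤ) • z) κ) : 𝔸ˣ) : 𝔸) * tsum (avgIter L U₀ k) (G k) ((L : ℤ) • z) (seg κ (L : ℤ))
              * (((expUnit (Xavg L (avgIter L U₀ k) ((L : ℤ) • z) κ))⁻¹ : 𝔸ˣ) : 𝔸))
          - (CM k (G k) z - conjR (avgIter L U₀ (k + 1) z κ) (CM k (G k) (z + e κ))) + rem k z κ) ∧
      ∀ (k : ℕ) (z : LSite d), Λ (k + 1) z = CM k (G k) z + Λ k ((L : ℤ) • z) := by
  let G : ℕ → LSite d → Fin d → 𝔸 := fun k => Nat.rec (motive := fun _ => LSite d → Fin d → 𝔸) Y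
    (fun k Gk => fun z κ =>
      (fderiv ℂ (eml : ((Fin d → Fin L) → 𝔸) → 𝔸) (fun r => ((Wcx L (avgIter L U₀ k) ((L : ℤ) • z) κ (boxVec L r) : 𝔸ˣ) : 𝔸))
            (fun r => tsum (avgIter L U₀ k) Gk ((L : ℤ) • z) (gammaWord L κ (boxVec L r) ++ seg κ (-(L : ℤ)))
              * ((Wcx L (avgIter L U₀ k) ((L : ℤ) • z) κ (boxVec L r) : 𝔸ˣ) : 𝔸))
            * (((expUnit (Xavg L (avgIter L U₀ k) ((L : ℤ) • z) κ))⁻¹ : 𝔸ˣ) : 𝔸)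
          + ((expUnit (Xavg L (avgIter L U₀ k) ((L : ℤ) • z) κ) : 𝔸ˣ) : 𝔸) * tsum (avgIter L U₀ k) Gk ((L : ℤ) • z) (seg κ (L : ℤ))
            * (((expUnit (Xavg L (avgIter L U₀ k) ((L : ℤ) • z) κ))⁻¹ : 𝔸ˣ) : 𝔸))
        - (CM k Gk z - conjR (avgIter L U₀ (k + 1) z κ) (CM k Gk (z + e κ))) + rem k z κ) k
  refine ⟨G, fun k => Nat.rec (motive := fun _ => LSite d → 𝔸) (fun _ => 0) (fun k Λk => fun z => CM k (G k) z + Λk ((L : ℤ) • z)) k,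
    rfl, fun _ => rfl, fun k z κ => rfl, fun k z => rfl⟩

/-- **The gauge function of a given family exists** (`Λ 0 = 0`, `Λ (k+1) y = CM k (G k) y + Λ k (L•y)`). Zero content. [cite: Balaban1984PropagatorsI, (1.18)–(1.20)] -/
theorem exists_gauge_family (L : ℕ) (CM : ℕ → (LSite d → Fin d → 𝔸) → LSite d → 𝔸) (G : ℕ → LSite d → Fin d → 𝔸) :
    ∃ Λ : ℕ → LSite d → 𝔸, (∀ z, Λ 0 z = 0) ∧ ∀ (k : ℕ) (z : LSite d), Λ (k + 1) z = CM k (G k) z + Λ k ((L : ℤ) • z) :=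
  ⟨fun k => Nat.rec (motive := fun _ => LSite d → 𝔸) (fun _ => 0) (fun k Λk => fun z => CM k (G k) z + Λk ((L : ℤ) • z)) k, fun _ => rfl, fun _ _ => rfl⟩

/-- The corner charges of the lane, `CM k X y := F̂^{Ūᵏ}X(L•y)`, are additive in the field (lit ✓`FhatCov_add`). [cite: Balaban1985Averaging, (112) p.34] -/
theorem cornerCharge_add (L : ℕ) (U₀ : LSite d → Fin d → 𝔸ˣ) (k : ℕ) (X X' : LSite d → Fin d → 𝔸) (y : LSite d) :
    FhatCov L (avgIter L U₀ k) (X + X') ((L : ℤ) • y) = FhatCov L (avgIter L U₀ k) X ((L : ℤ) • y) + FhatCov L (avgIter L U₀ k) X' ((L : ℤ) • y) :=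
  FhatCov_add L _ X X' _

/-- ★ **THE SOURCE SPLITS OFF LINEARLY**: for additive corner charges `CM k`, if `G^{lin}` obeys the SOURCELESS reduced recursion and `N` the SOURCED one (source `rem`), then
`G̃ := G^{lin} + N` obeys the sourced recursion — ✓`trueStep_add` + additivity of `CM k` + `conjR_add`.  With `G^{lin} 0 = Y`, `N 0 = 0` this is the decomposition of ✓F-7a's
family into the true-linear reduced tower of `Y` and the remainder driven by the source alone (the mass line carries the source; the gradient line runs sourceless on `G^{lin}`).
[cite: Balaban1985Averaging, (119)–(122) pp.35–36, (68) p.29] -/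
theorem sourced_recursion_of_split (L : ℕ) (U₀ : LSite d → Fin d → 𝔸ˣ) (CM : ℕ → (LSite d → Fin d → 𝔸) → LSite d → 𝔸)
    (hCM : ∀ (k : ℕ) (X X' : LSite d → Fin d → 𝔸) (y : LSite d), CM k (X + X') y = CM k X y + CM k X' y)
    (rem : ℕ → LSite d → Fin d → 𝔸) (Glin Nn : ℕ → LSite d → Fin d → 𝔸)
    (hGlin : ∀ (k : ℕ) (z : LSite d) (κ : Fin d), Glin (k + 1) z κ
      = (fderiv ℂ (eml : ((Fin d → Fin L) → 𝔸) → 𝔸) (fun r => ((Wcx L (avgIter L U₀ k) ((L : ℤ) • z) κ (boxVec L r) : 𝔸ˣ) : 𝔸))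
            (fun r => tsum (avgIter L U₀ k) (Glin k) ((L : ℤ) • z) (gammaWord L κ (boxVec L r) ++ seg κ (-(L : ℤ)))
              * ((Wcx L (avgIter L U₀ k) ((L : ℤ) • z) κ (boxVec L r) : 𝔸ˣ) : 𝔸))
            * (((expUnit (Xavg L (avgIter L U₀ k) ((L : ℤ) • z) κ))⁻¹ : 𝔸ˣ) : 𝔸)
          + ((expUnit (Xavg L (avgIter L U₀ k) ((L : ℤ) • z) κ) : 𝔸ˣ) : 𝔸) * tsum (avgIter L U₀ k) (Glin k) ((L : ℤ) • z) (seg κ (L : ℤ))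
            * (((expUnit (Xavg L (avgIter L U₀ k) ((L : ℤ) • z) κ))⁻¹ : 𝔸ˣ) : 𝔸))
        - (CM k (Glin k) z - conjR (avgIter L U₀ (k + 1) z κ) (CM k (Glin k) (z + e κ))))
    (hN : ∀ (k : ℕ) (z : LSite d) (κ : Fin d), Nn (k + 1) z κ
      = (fderiv ℂ (eml : ((Fin d → Fin L) → 𝔸) → 𝔸) (fun r => ((Wcx L (avgIter L U₀ k) ((L : ℤ) • z) κ (boxVec L r) : 𝔸ˣ) : 𝔸))
            (fun r => tsum (avgIter L U₀ k) (Nn k) ((L : ℤ) • z) (gammaWord L κ (boxVec L r) ++ seg κ (-(L : ℤ)))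
              * ((Wcx L (avgIter L U₀ k) ((L : ℤ) • z) κ (boxVec L r) : 𝔸ˣ) : 𝔸))
            * (((expUnit (Xavg L (avgIter L U₀ k) ((L : ℤ) • z) κ))⁻¹ : 𝔸ˣ) : 𝔸)
          + ((expUnit (Xavg L (avgIter L U₀ k) ((L : ℤ) • z) κ) : 𝔸ˣ) : 𝔸) * tsum (avgIter L U₀ k) (Nn k) ((L : ℤ) • z) (seg κ (L : ℤ))
            * (((expUnit (Xavg L (avgIter L U₀ k) ((L : ℤ) • z) κ))⁻¹ : 𝔸ˣ) : 𝔸))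
        - (CM k (Nn k) z - conjR (avgIter L U₀ (k + 1) z κ) (CM k (Nn k) (z + e κ))) + rem k z κ) :
    ∀ (k : ℕ) (z : LSite d) (κ : Fin d), (Glin (k + 1) + Nn (k + 1)) z κ
      = (fderiv ℂ (eml : ((Fin d → Fin L) → 𝔸) → 𝔸) (fun r => ((Wcx L (avgIter L U₀ k) ((L : ℤ) • z) κ (boxVec L r) : 𝔸ˣ) : 𝔸))
            (fun r => tsum (avgIter L U₀ k) (Glin k + Nn k) ((L : ℤ) • z) (gammaWord L κ (boxVec L r) ++ seg κ (-(L : ℤ)))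
              * ((Wcx L (avgIter L U₀ k) ((L : ℤ) • z) κ (boxVec L r) : 𝔸ˣ) : 𝔸))
            * (((expUnit (Xavg L (avgIter L U₀ k) ((L : ℤ) • z) κ))⁻¹ : 𝔸ˣ) : 𝔸)
          + ((expUnit (Xavg L (avgIter L U₀ k) ((L : ℤ) • z) κ) : 𝔸ˣ) : 𝔸) * tsum (avgIter L U₀ k) (Glin k + Nn k) ((L : ℤ) • z) (seg κ (L : ℤ))
            * (((expUnit (Xavg L (avgIter L U₀ k) ((L : ℤ) • z) κ))⁻¹ : 𝔸ˣ) : 𝔸))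
        - (CM k (Glin k + Nn k) z - conjR (avgIter L U₀ (k + 1) z κ) (CM k (Glin k + Nn k) (z + e κ))) + rem k z κ := by
  intro k z κ
  rw [Pi.add_apply, Pi.add_apply, hGlin, hN, trueStep_add, hCM, hCM, conjR_add]
  abel

end Summit.QuantumFields.YangMills.Theorems.Prop7CornerCombFamiliesPeriodic

end
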